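import Mathlib
import Literature.MathematicalPhysics.QuantumFieldTheory.Balaban1983to89.B14Eq350Kernel

/-!
# `Balaban1983to89.B14Eq358Covariance` — T. Bałaban, *Convergent renormalization expansions for lattice gauge theories*,
# Commun. Math. Phys. **119** (1988) 243–285 [Balaban1988Convergent]: (3.58) p. 282 *"Euclidean covariance following from
# (2.29)"* and its *"conclusion"* (3.59) for the second-derivative kernel (3.50) — both PROVED at mechanism level for the
# typed `B14.Eq350Kernel.E2` / `kernel350` (they were carried as hypotheses of `B14Sect3.invariant_tensor_361`)

statement-level skeleton of published theorems with citation tags; proofs where landed; nothing here is a claim about the Yang–Mills mass gap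

PDF held: `paper:balaban1988-cmp119-convergent-renormalization` (journal page = PDF page + 242); pp. 281–282 read on the
x2 renders `…-p039-x2.png`, `…-p040-x2.png` of
`run/shared/lean/pub/pub-balaban/b2b-balaban-ref1/pages/1988-cmp119-convergent-renormalization/`.

CITATION HEADER (lean-in-tree rule).  WHAT IS REPRODUCED, verbatim, p. 281–282 [PDF 39–40]: *"… Euclidean covariance
following from (2.29). It can be reformulated as 𝐄^{(j)}(U_j(exp irB), rz) = 𝐄^{(j)}(U_j(exp iB), z), (3.58) where rB
represents the configuration (rB)_μ(x) = (rB)_μ(r⁻¹x). … Keeping in mind these different meanings of the symbol r, we write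
the following conclusion of the covariance (3.58) ((r⁻¹⊗r⁻¹)Π^{(j)})_{μν}(rx, ry, rz) = Π^{(j)}_{μν}(x, y, z). (3.59)"* —
SKELETON row **B14.Eq3.58–3.61** (ROWS-B14 ≤ v1.18: *"(3.58)–(3.59) as statements on the carrier: typed as hypotheses of
`invariant_tensor_361`"*).

THE TYPED READING (mechanism level; the objects are those of `B14.Eq350Kernel`: `F_z = [B ↦ 𝐄^{(j)}(X, U_j(exp iB), z)]`
on the configuration space `ι → 𝔤`, `E2 F i j a b` = the second Fréchet derivative at `B = 0` on coordinate directions,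
`kernel350` its scalar components).
* (2.29) ⇒ (3.58) (`eq358_of_229`): with the covariance (2.29) of the point functions, `𝐄(rU, rz) = 𝐄(U, z)`, and the
  covariance of the background-field map, `U_j(exp i(rB)) = r·U_j(exp iB)` ([15]; both explicit hypotheses on abstract
  actions), `𝐄(U_j(exp irB), rz) = 𝐄(U_j(exp iB), z)` — i.e. `F_{rz} ∘ R = F_z` for the linear action `R : B ↦ rB`.
* (3.58) ⇒ (3.59) (`E2_comp_clm`, **`eq359`**): differentiating `F_{rz} ∘ R = F_z` twice at `B = 0` (chain rule for the
  continuous linear `R`, Mathlib `ContinuousLinearMap.iteratedFDerivWithin_comp_right`; `F_{rz}` of class `C²` on an open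
  neighbourhood of `0` — (2.27)(ii)) gives `D²F_z(0)(u, v) = D²F_{rz}(0)(Ru, Rv)`, the coordinate-free (3.59); for a
  lattice symmetry acting on the bond variables monomially, `R e_p = s_p e_{ρp}` (signed permutation: the *"different
  meanings of the symbol r"* and the reflection example `(rB)_μ(x) = −B_μ(…)` of p. 282 are absorbed in `ρ`, `s`),
  `Π_z(p, q) = s_p s_q Π_{rz}(ρp, ρq)` (`kernel350_comp_monomial`) — the printed (3.59) with `(r⁻¹⊗r⁻¹)` realised by the
  signs/permutation of directions.  (3.60) (contraction with the moments and (I.4.15)) and its consequences stay in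
  `B14Sect3` (`invariant_tensor_361`).

Mega-formalization `lit-balaban`, unit `lit-balaban-r11` gen 4 (B14 fold owner), HOME `run/shared/lean/pub/lit-balaban/`.

## References
* [Balaban1988Convergent] T. Bałaban, Commun. Math. Phys. 119 (1988) 243–285, (3.58)–(3.59) p. 282; (2.29) p. 260;
  (3.50) p. 280.
-/

noncomputable section

namespace Literature.MathematicalPhysics.QuantumFieldTheory.Balaban1983to89.B14.Eq358Covariance

open Literature.MathematicalPhysics.QuantumFieldTheory.Balaban1983to89.B14.Eq350Kernel

/-! ## §1. (2.29) ⇒ (3.58) -/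

section Eq358

variable {Cfg Pt Bfld : Type*}

/-- **(3.58) from (2.29)**, as printed (*"Euclidean covariance following from (2.29). It can be reformulated as
𝐄^{(j)}(U_j(exp irB), rz) = 𝐄^{(j)}(U_j(exp iB), z)"*): given the covariance (2.29) of the point functions under the
actions of `r` on configurations and points, and the covariance of the background-field map `B ↦ U_j(exp iB)` under the
actions on `B` and on configurations ([15]), (3.58) holds. [cite: Balaban1988Convergent, (3.58) p.282] -/
theorem eq358_of_229 (E : Cfg → Pt → ℝ) (Uj : Bfld → Cfg) (rU : Cfg → Cfg) (rz : Pt → Pt) (rB : Bfld → Bfld)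
    (h229 : ∀ U z, E (rU U) (rz z) = E U z) (hcov : ∀ B, Uj (rB B) = rU (Uj B)) (B : Bfld) (z : Pt) :
    E (Uj (rB B)) (rz z) = E (Uj B) z := by
  rw [hcov, h229]

/-- (3.58) in function form: `F_{rz} ∘ R = F_z` for `F_w := [B ↦ 𝐄(U_j(exp iB), w)]` and `R := [B ↦ rB]`.
[cite: Balaban1988Convergent, (3.58) p.282] -/
theorem eq358_comp (E : Cfg → Pt → ℝ) (Uj : Bfld → Cfg) (rU : Cfg → Cfg) (rz : Pt → Pt) (rB : Bfld → Bfld)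
    (h229 : ∀ U z, E (rU U) (rz z) = E U z) (hcov : ∀ B, Uj (rB B) = rU (Uj B)) (z : Pt) :
    (fun B => E (Uj B) (rz z)) ∘ rB = fun B => E (Uj B) z := by
  funext B
  exact eq358_of_229 E Uj rU rz rB h229 hcov B z

end Eq358

/-! ## §2. (3.58) ⇒ (3.59): the second-derivative kernel is covariant -/

section Eq359

variable {ι : Type*} [Fintype ι] [DecidableEq ι] {𝔤 : Type*} [NormedAddCommGroup 𝔤] [NormedSpace ℝ 𝔤]

/-- **Chain rule behind (3.59)**: if `F_z = F′ ∘ R` with `R` continuous linear (`R 0 = 0`) and `F′` of class `C²` on an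
open set containing `0`, then the (3.50) bilinear form of `F_z` is that of `F′` on the transformed directions:
`E2 (F′ ∘ R) i j a b = D²F′(0)(R e_i a, R e_j b)`. [cite: Balaban1988Convergent, (3.59) p.282] -/
theorem E2_comp_clm {s : Set (ι → 𝔤)} (hs : IsOpen s) (h0 : (0 : ι → 𝔤) ∈ s) {F' : (ι → 𝔤) → ℝ}
    (hF' : ContDiffOn ℝ 2 F' s) (R : (ι → 𝔤) →L[ℝ] (ι → 𝔤)) (i j : ι) (a b : 𝔤) :
    E2 (F' ∘ R) i j a b = iteratedFDeriv ℝ 2 F' 0 ![R (Pi.single i a), R (Pi.single j b)] := by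
  rw [E2_eq_iteratedFDeriv]
  have hs' : IsOpen (R ⁻¹' s) := hs.preimage R.continuous
  have h0' : (0 : ι → 𝔤) ∈ R ⁻¹' s := by simp [h0]
  have hR0 : R 0 ∈ s := by simpa using h0
  rw [← iteratedFDerivWithin_of_isOpen 2 hs' h0',
    R.iteratedFDerivWithin_comp_right hF' hs.uniqueDiffOn hs'.uniqueDiffOn hR0 (i := 2) le_rfl,
    ContinuousMultilinearMap.compContinuousLinearMap_apply, map_zero, iteratedFDerivWithin_of_isOpen 2 hs h0]
  congr 1
  funext k
  fin_cases k <;> rfl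

/-- **(3.59), coordinate-free, from (3.58)**: `F_{rz} ∘ R = F_z` ⇒ `D²F_z(0)(e_i a, e_j b) = D²F_{rz}(0)(R e_i a, R e_j b)`.
[cite: Balaban1988Convergent, (3.59) p.282] -/
theorem eq359 {s : Set (ι → 𝔤)} (hs : IsOpen s) (h0 : (0 : ι → 𝔤) ∈ s) {Fz Frz : (ι → 𝔤) → ℝ}
    (hFrz : ContDiffOn ℝ 2 Frz s) (R : (ι → 𝔤) →L[ℝ] (ι → 𝔤)) (h358 : Frz ∘ R = Fz) (i j : ι) (a b : 𝔤) :
    E2 Fz i j a b = iteratedFDeriv ℝ 2 Frz 0 ![R (Pi.single i a), R (Pi.single j b)] := by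
  rw [← h358]
  exact E2_comp_clm hs h0 hFrz R i j a b

omit [DecidableEq ι] in
/-- Bilinearity of the second derivative on scaled directions: `D²F(0)(c•u, c′•v) = c c′ D²F(0)(u, v)`.
[cite: Balaban1988Convergent, (3.59) p.282] -/
theorem iteratedFDeriv_two_smul (F : (ι → 𝔤) → ℝ) (c c' : ℝ) (u v : ι → 𝔤) :
    iteratedFDeriv ℝ 2 F 0 ![c • u, c' • v] = c * c' * iteratedFDeriv ℝ 2 F 0 ![u, v] := by
  rw [iteratedFDeriv_two_apply, iteratedFDeriv_two_apply]
  simp only [Matrix.cons_val_zero, Matrix.cons_val_one, map_smul, FunLike.coe_smul,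
    Pi.smul_apply, smul_eq_mul]
  ring

/-- When `R` acts MONOMIALLY on the coordinate directions — `R(e_i a) = s_i • e_{ρ i}(a)`, a signed relabelling of the bond
variables (lattice symmetries: `ρ` moves the bond, `s = −1` on the bonds a reflection reverses, p. 282's example
`(rB)_μ(x) = −B_μ((…, −x_μ−1, …))`) — the bilinear form transforms entrywise:
`E2 (F′ ∘ R) i j a b = s_i s_j · E2 F′ (ρ i) (ρ j) a b`. [cite: Balaban1988Convergent, (3.59) p.282] -/
theorem E2_comp_monomial {s : Set (ι → 𝔤)} (hs : IsOpen s) (h0 : (0 : ι → 𝔤) ∈ s) {F' : (ι → 𝔤) → ℝ}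
    (hF' : ContDiffOn ℝ 2 F' s) (R : (ι → 𝔤) →L[ℝ] (ι → 𝔤)) (ρ : ι → ι) (sg : ι → ℝ)
    (hR : ∀ (i : ι) (a : 𝔤), R (Pi.single i a) = sg i • Pi.single (ρ i) a) (i j : ι) (a b : 𝔤) :
    E2 (F' ∘ R) i j a b = sg i * sg j * E2 F' (ρ i) (ρ j) a b := by
  rw [E2_comp_clm hs h0 hF' R, hR, hR, iteratedFDeriv_two_smul, E2_eq_iteratedFDeriv]

end Eq359

/-! ## §3. (3.59) for the printed scalar kernel `𝐄^{(2)}_{μν}(X, x, y, z)` -/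

section Kernel

variable {d : ℕ} {X : Type*} [Fintype X] [DecidableEq X]

/-- **(3.59) PROVED for `kernel350`**: if the bond-variable action of the lattice symmetry `r` is the signed relabelling
`R e_{(μ,x)} = s(μ,x) • e_{ρ(μ,x)}` (direction index and point transformed, sign for reversed bonds) and (3.58) holds in
the form `F_{rz} ∘ R = F_z` with `F_{rz}` of class `C²` near `0`, then
`Π_z(μ, ν; x, y) = s(μ,x) s(ν,y) Π_{rz}(ρ(μ,x), ρ(ν,y))` — the printed `((r⁻¹⊗r⁻¹)Π^{(j)})_{μν}(rx, ry, rz) = Π^{(j)}_{μν}(x,y,z)`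
with `r⁻¹ ⊗ r⁻¹` realised by the signed permutation of the direction indices. [cite: Balaban1988Convergent, (3.59) p.282] -/
theorem kernel350_comp_monomial {s : Set (Fin d × X → ℝ)} (hs : IsOpen s) (h0 : (0 : Fin d × X → ℝ) ∈ s)
    {Fz Frz : (Fin d × X → ℝ) → ℝ} (hFrz : ContDiffOn ℝ 2 Frz s) (R : (Fin d × X → ℝ) →L[ℝ] (Fin d × X → ℝ))
    (ρ : Fin d × X → Fin d × X) (sg : Fin d × X → ℝ)
    (hR : ∀ (p : Fin d × X) (a : ℝ), R (Pi.single p a) = sg p • Pi.single (ρ p) a) (h358 : Frz ∘ R = Fz)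
    (μ ν : Fin d) (x y : X) :
    kernel350 Fz μ ν x y
      = sg (μ, x) * sg (ν, y) * kernel350 Frz (ρ (μ, x)).1 (ρ (ν, y)).1 (ρ (μ, x)).2 (ρ (ν, y)).2 := by
  unfold kernel350
  rw [← h358, E2_comp_monomial hs h0 hFrz R ρ sg hR]

/-- The invariance form used for (3.60): for a symmetry FIXING `z` (`F_{rz} = F_z`, the sentence after (2.29): *"the
function 𝐄^{(j)}(U_j, z) is invariant with respect to the Euclidean transformations of U_j leaving the point z
invariant"*), the kernel is invariant under the signed relabelling: `Π_z(p, q) = s_p s_q Π_z(ρp, ρq)` — the input of the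
reflection/permutation analysis `B14Sect3.refl_invariant_vanish` / `perm_invariant_diag` once contracted to (3.60).
[cite: Balaban1988Convergent, (3.59)–(3.60) p.282] -/
theorem kernel350_invariant_of_fix {s : Set (Fin d × X → ℝ)} (hs : IsOpen s) (h0 : (0 : Fin d × X → ℝ) ∈ s)
    {Fz : (Fin d × X → ℝ) → ℝ} (hFz : ContDiffOn ℝ 2 Fz s) (R : (Fin d × X → ℝ) →L[ℝ] (Fin d × X → ℝ))
    (ρ : Fin d × X → Fin d × X) (sg : Fin d × X → ℝ)
    (hR : ∀ (p : Fin d × X) (a : ℝ), R (Pi.single p a) = sg p • Pi.single (ρ p) a) (hinv : Fz ∘ R = Fz)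
    (μ ν : Fin d) (x y : X) :
    kernel350 Fz μ ν x y
      = sg (μ, x) * sg (ν, y) * kernel350 Fz (ρ (μ, x)).1 (ρ (ν, y)).1 (ρ (μ, x)).2 (ρ (ν, y)).2 :=
  kernel350_comp_monomial hs h0 hFz R ρ sg hR hinv μ ν x y

end Kernel

end Literature.MathematicalPhysics.QuantumFieldTheory.Balaban1983to89.B14.Eq358Covariance
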